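import Summits.CriticalPhenomena.Ising3D.TaylorTableOddHeadDeltaMerged

/-!
# Merged odd head final: monotonicity in the row count `J` (BOX 3 claim glue)

(cell `pub-ising3x`, lead gen 28 draft 2026-08-24; HONEST FRAMING: lottery ticket; floor = tightest certified
3D Ising CFT bounds; no exact-solution claim without a proof.)

`oddHeadFinalOKΔM R dP C t₁ t₂ K Mσ Mε κ₀ ps` reads the row object `R` only through `R.S`, `R.Wσ`, `R.Wε`
(via `R.Wb`, `R.Wt`) and — in its structural half `oddHeadStructOK` — through the test `C.F.all (·.2 < R.J)`,
which is MONOTONE in `R.J`.  Hence a final certified for a row object with `J` rows transfers to any row object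
with the same `S, Wσ, Wε` and AT LEAST `J` rows.  This is the composition step the BOX 3 replay of record needs:
its order-0 odd cells are replayed with `J = 40`, its deepened / merged-2 cells with `J = 56`, and the single row
object `HO.R` of the odd head certificate is the `J = 56` object whose `ValidΔ` the rows-only region set certifies
(`TaylorTableCertB3OddRowsLegs`).  The equal-`J` case is `oddHeadFinalOKΔM_congr_rows` (TaylorTableHeadPartsRows).
-/

namespace Summit.CriticalPhenomena.Ising3D
open Literature.Analysis.ValidatedNumerics.NumericsMP (MI)

/-- The structural half of the merged odd final is monotone in the row count: it reads `R` only through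
`C.F.all (·.2 < R.J)`. [folklore] -/
theorem oddHeadStructOK_mono_J {R R' : OddHeadRowsΔ} (hJ : R.J ≤ R'.J) (C : EvenCellTM) (t₁ t₂ κ₀ : ℚ)
    (ps : List HeadPartOdd) (h : oddHeadStructOK R C t₁ t₂ κ₀ ps = true) :
    oddHeadStructOK R' C t₁ t₂ κ₀ ps = true := by
  simp only [oddHeadStructOK, Bool.and_eq_true, List.all_eq_true, decide_eq_true_eq] at h ⊢
  obtain ⟨⟨⟨⟨⟨hD, hpiv⟩, ht⟩, hκ⟩, hF⟩, htiles⟩ := h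
  exact ⟨⟨⟨⟨⟨hD, hpiv⟩, ht⟩, hκ⟩, fun q hq => lt_of_lt_of_le (hF q hq) hJ⟩, htiles⟩

/-- **The merged odd final transfers from a row object with fewer rows to one with more rows** (same `S`, `Wσ`,
`Wε`; `R.J ≤ R'.J`). [folklore] -/
theorem oddHeadFinalOKΔM_mono_J {R R' : OddHeadRowsΔ} (hS : R.S = R'.S) (hJ : R.J ≤ R'.J) (hWσ : R.Wσ = R'.Wσ)
    (hWε : R.Wε = R'.Wε) (dP : ℕ) (C : EvenCellTM) (t₁ t₂ : ℚ) (K Mσ Mε : MI) (κ₀ : ℚ) (ps : List HeadPartOdd)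
    (h : oddHeadFinalOKΔM R dP C t₁ t₂ K Mσ Mε κ₀ ps = true) :
    oddHeadFinalOKΔM R' dP C t₁ t₂ K Mσ Mε κ₀ ps = true := by
  have hb : R'.Wb = R.Wb := by rw [OddHeadRowsΔ.Wb, OddHeadRowsΔ.Wb, hWσ, hWε]
  have hw : R'.Wt = R.Wt := by rw [OddHeadRowsΔ.Wt, OddHeadRowsΔ.Wt, hWσ, hWε]
  simp only [oddHeadFinalOKΔM, Bool.and_eq_true] at h ⊢
  refine ⟨oddHeadStructOK_mono_J hJ C t₁ t₂ κ₀ ps h.1, ?_⟩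
  rw [← hS, hb, hw, ← hWσ]
  exact h.2

end Summit.CriticalPhenomena.Ising3D
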